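import Summits.CriticalPhenomena.Ising3DConformalLimit.Theorems.IsingEuclidUpgradeR4NonGaussianFatStep
import Summits.CriticalPhenomena.Ising3DConformalLimit.Theorems.PerfectScreeningGaussianLimitNotScreenedDefs
import HarnessLib

/-!
# Crux `GaussianLimitNotScreened` (stmt-CriticalPhenomena-13886, route PerfectScreening r4), line
# `karamata-amplitude-blind-merging`: estimates for the registered stub `stub_oneArmAsymptotics`
# (helper file 1/2 — THEOREM-ONLY, no definitions)

The one-arm moments `M₁ = oneArmMoment₁`, `M₂ = oneArmMoment₂`, `E_s = energyMoment` of the free box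
`Λ_L ⊂ ℤ³` at `β_c` (vocabulary of `PerfectScreeningGaussianLimitNotScreenedDefs`, ADC21 App. A
Prop. A.3) converge termwise, as `L → ∞`, to the same finite sums with the box two-point function
`G_L` replaced by the critical pair correlator `⟨σ_uσ_v⟩_{β_c}` (`criticalCorr_wellDefined_holds`, free
b.c.). This file collects, in the sub-namespace `OneArm`, the amplitude-blind pieces of the proof of
`stub_oneArmAsymptotics` (pattern of the landed `stub_momentRatioLowerBound` of crux 0636):

* §A the `L → ∞` dictionary (`tendsto_oneArmMoment₁/₂`, `tendsto_energyMoment`);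
* §B the elementary real arithmetic turning the two-point WINDOW `ℓ ≤ ρ(δ)²⟨σσ⟩ ≤ U` on the sources
  and the counting region into `M₁ ≥ |A| ℓ²/(Uρ²)`, `M₂ ≤ (2U²/(ℓρ²)) ∑_{v,w ∈ A} ⟨σ_vσ_w⟩`,
  `E_s ≤ (2U²/(ℓρ²)) ∑_{v ≠ w ∈ A} ‖v − w‖^{−s}⟨σ_vσ_w⟩` — only RATIOS of two-point functions occur,
  the amplitude `ρ(δ)²` is never bounded;
* §C translation invariance: the inner sums over the region `A = Λ_n + p` are lattice sums over
  `Λ_{2n}`;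
* §D the mesh integers `n = ⌊1/δ⌋ − 1`, `2^J ≤ n < 2^{J+1}`;
* §E the final real arithmetic of the three conclusions `M₁² ≥ 2c₁M₂`, `E_s ≤ (c₂/2)R^{−s}M₁²`,
  `2Rˢ < M₁` (the amplitude cancels in the first two; the third uses a two-point LOWER bound at the
  source pair, supplied by the existence of `η` in the companion file `…OneArmAsymptoticsGeometry`).

References: M. Aizenman, H. Duminil-Copin, Ann. of Math. 194 (2021) = arXiv:1912.07973, §4.2 Lemma 4.4,
App. A Prop. A.3.
-/

noncomputable section

open Filter Topology Set Function MeasureTheory Finset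
open Literature.Probability.LatticeModels Literature.Probability.Percolation
open Summit.CriticalPhenomena.Ising3DConformalLimit.Cruxes.IsingEuclidUpgradeR4NonGaussian.FreeCovarianceDeltaDichotomy
  (lat boxG threePointRatio twoStep ScaleCovariantOn criticalCorr_two_pos' stub_momentRatioWindow
    eventually_lat_mem_box)
open scoped symmDiff

namespace Summit.CriticalPhenomena.Ising3DConformalLimit.Cruxes.GaussianLimitNotScreened.KaramataAmplitudeBlindMerging

namespace OneArm

/-! ## §A. `Λ_L ↑ ℤ³`: the one-arm moments converge termwise -/

/-- The free box two-point function converges to the critical pair correlator. [folklore] -/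
theorem tendsto_boxG (u v : Site 3) :
    Tendsto (fun L => boxG L u v) atTop (𝓝 (criticalCorr 3 2 ![u, v])) := by
  -- adapted from `FreeCovarianceDeltaDichotomy.tendsto_boxG` (IsingEuclidUpgradeR4NonGaussianMomentRatioLowerBound)
  have hmem : (BoundaryCondition.free : BoundaryCondition (Site 3)) ∈
      ({.free, .plus, .minus} : Set (BoundaryCondition (Site 3))) := by simp
  have h := criticalCorr_wellDefined_holds (d := 3) le_rfl 2 ![u, v] .free hmem
  refine Tendsto.congr (fun L => ?_) h
  simp only [boxG, isingTwoPoint, spinMonomial_two]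

/-- `L → ∞` limit of the three-point ratio `G_L(a,v)G_L(v,b)/G_L(a,b)`. [folklore] -/
theorem tendsto_threePointRatio (a b v : Site 3) :
    Tendsto (fun L => threePointRatio L a b v) atTop
      (𝓝 (criticalCorr 3 2 ![a, v] * criticalCorr 3 2 ![v, b] / criticalCorr 3 2 ![a, b])) :=
  ((tendsto_boxG a v).mul (tendsto_boxG v b)).div (tendsto_boxG a b) (criticalCorr_two_pos' a b).ne'

/-- `L → ∞` limit of the two-step kernel divided by the pair correlator. [folklore] -/
theorem tendsto_twoStep_div (a b v w : Site 3) :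
    Tendsto (fun L => twoStep L a b v w / boxG L a b) atTop
      (𝓝 ((criticalCorr 3 2 ![a, v] * criticalCorr 3 2 ![v, w] * criticalCorr 3 2 ![w, b] +
        criticalCorr 3 2 ![a, w] * criticalCorr 3 2 ![w, v] * criticalCorr 3 2 ![v, b]) /
        criticalCorr 3 2 ![a, b])) :=
  ((((tendsto_boxG a v).mul (tendsto_boxG v w)).mul (tendsto_boxG w b)).add
    (((tendsto_boxG a w).mul (tendsto_boxG w v)).mul (tendsto_boxG v b))).div (tendsto_boxG a b)
    (criticalCorr_two_pos' a b).ne'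

/-- `L → ∞` limit of the first one-arm moment `M₁` (`G` = the critical pair correlator). [folklore] -/
theorem tendsto_oneArmMoment₁ {G : Site 3 → Site 3 → ℝ}
    (hG : ∀ u v, G u v = criticalCorr 3 2 ![u, v]) (a b : Site 3) (A : Finset (Site 3)) :
    Tendsto (fun L => oneArmMoment₁ L a b A) atTop (𝓝 (∑ v ∈ A, G a v * G v b / G a b)) := by
  obtain rfl : G = fun u v => criticalCorr 3 2 ![u, v] := funext fun u => funext fun v => hG u v
  exact tendsto_finsetSum A fun v _ => tendsto_threePointRatio a b v

/-- `L → ∞` limit of the second-moment bound `M₂` (`G` = the critical pair correlator). [folklore] -/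
theorem tendsto_oneArmMoment₂ {G : Site 3 → Site 3 → ℝ}
    (hG : ∀ u v, G u v = criticalCorr 3 2 ![u, v]) (a b : Site 3) (A : Finset (Site 3)) :
    Tendsto (fun L => oneArmMoment₂ L a b A) atTop
      (𝓝 (∑ v ∈ A, ∑ w ∈ A, (G a v * G v w * G w b + G a w * G w v * G v b) / G a b)) := by
  obtain rfl : G = fun u v => criticalCorr 3 2 ![u, v] := funext fun u => funext fun v => hG u v
  exact tendsto_finsetSum A fun v _ => tendsto_finsetSum A fun w _ => tendsto_twoStep_div a b v w

/-- `L → ∞` limit of the energy moment `E_s` (`G` = the critical pair correlator). [folklore] -/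
theorem tendsto_energyMoment {G : Site 3 → Site 3 → ℝ}
    (hG : ∀ u v, G u v = criticalCorr 3 2 ![u, v]) (a b : Site 3) (s : ℝ) (A : Finset (Site 3)) :
    Tendsto (fun L => energyMoment L a b s A) atTop
      (𝓝 (∑ v ∈ A, ∑ w ∈ A.erase v, (‖v - w‖ : ℝ) ^ (-s) *
        ((G a v * G v w * G w b + G a w * G w v * G v b) / G a b))) := by
  obtain rfl : G = fun u v => criticalCorr 3 2 ![u, v] := funext fun u => funext fun v => hG u v
  exact tendsto_finsetSum A fun v _ => tendsto_finsetSum _ fun w _ =>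
    (tendsto_twoStep_div a b v w).const_mul _

/-! ## §B. The window turned into moment bounds (only ratios of two-point functions occur) -/

/-- Lower bound for a three-point ratio `pq/g` from `ℓ ≤ rp`, `ℓ ≤ rq`, `rg ≤ U`. [folklore] -/
theorem ratio_lower {r ℓ U p q g : ℝ} (hr : 0 < r) (hℓ : 0 < ℓ) (hp : ℓ ≤ r * p)
    (hq : ℓ ≤ r * q) (hg : 0 < g) (hgU : r * g ≤ U) : ℓ ^ 2 / (U * r) ≤ p * q / g := by
  -- adapted from `FreeCovarianceDeltaDichotomy.ratio_lower` (IsingEuclidUpgradeR4NonGaussianMomentRatioLowerBound)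
  have hU : 0 < U := lt_of_lt_of_le (mul_pos hr hg) hgU
  rw [div_le_div_iff₀ (mul_pos hU hr) hg]
  have h1 : ℓ * ℓ ≤ (r * p) * (r * q) := mul_le_mul hp hq hℓ.le ((hℓ.le).trans hp)
  nlinarith [mul_le_mul_of_nonneg_left hgU (mul_nonneg (mul_nonneg hr.le hg.le) hℓ.le)]

/-- Upper bound for a two-step term `(p g q + p' g q')/t` from `rp, rq, rp', rq' ≤ U`, `ℓ ≤ rt`.
[folklore] -/
theorem twoStep_upper {r ℓ U p q p' q' g t : ℝ} (hr : 0 < r) (hℓ : 0 < ℓ) (hp0 : 0 ≤ p)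
    (hq0 : 0 ≤ q) (hp0' : 0 ≤ p') (hq0' : 0 ≤ q') (hg : 0 ≤ g) (hp : r * p ≤ U) (hq : r * q ≤ U)
    (hp' : r * p' ≤ U) (hq' : r * q' ≤ U) (ht : ℓ ≤ r * t) :
    (p * g * q + p' * g * q') / t ≤ 2 * U ^ 2 / (ℓ * r) * g := by
  -- adapted from `FreeCovarianceDeltaDichotomy.twoStep_upper` (IsingEuclidUpgradeR4NonGaussianMomentRatioLowerBound)
  have ht0 : 0 < t := by
    by_contra h
    push Not at h
    have : r * t ≤ 0 := mul_nonpos_of_nonneg_of_nonpos hr.le h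
    linarith
  have hU : 0 ≤ U := le_trans (mul_nonneg hr.le hp0) hp
  rw [div_mul_eq_mul_div, div_le_div_iff₀ ht0 (mul_pos hℓ hr)]
  have h1 : (r * p) * (r * q) ≤ U * U := mul_le_mul hp hq (mul_nonneg hr.le hq0) hU
  have h2 : (r * p') * (r * q') ≤ U * U := mul_le_mul hp' hq' (mul_nonneg hr.le hq0') hU
  have h3 : ℓ * (p * q) ≤ r * t * (p * q) := mul_le_mul_of_nonneg_right ht (mul_nonneg hp0 hq0)
  have h4 : ℓ * (p' * q') ≤ r * t * (p' * q') := mul_le_mul_of_nonneg_right ht (mul_nonneg hp0' hq0')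
  have h5 : ℓ * r * (p * q) ≤ U * U * t := by
    calc ℓ * r * (p * q) = r * (ℓ * (p * q)) := by ring
      _ ≤ r * (r * t * (p * q)) := mul_le_mul_of_nonneg_left h3 hr.le
      _ = t * ((r * p) * (r * q)) := by ring
      _ ≤ t * (U * U) := mul_le_mul_of_nonneg_left h1 ht0.le
      _ = U * U * t := by ring
  have h6 : ℓ * r * (p' * q') ≤ U * U * t := by
    calc ℓ * r * (p' * q') = r * (ℓ * (p' * q')) := by ring
      _ ≤ r * (r * t * (p' * q')) := mul_le_mul_of_nonneg_left h4 hr.le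
      _ = t * ((r * p') * (r * q')) := by ring
      _ ≤ t * (U * U) := mul_le_mul_of_nonneg_left h2 ht0.le
      _ = U * U * t := by ring
  calc (p * g * q + p' * g * q') * (ℓ * r)
      = g * (ℓ * r * (p * q)) + g * (ℓ * r * (p' * q')) := by ring
    _ ≤ g * (U * U * t) + g * (U * U * t) :=
      add_le_add (mul_le_mul_of_nonneg_left h5 hg) (mul_le_mul_of_nonneg_left h6 hg)
    _ = 2 * U ^ 2 * g * t := by ring

/-- **`M₁ ≥ |A| ℓ²/(Uρ²)`** in infinite volume, from the window on the sources and the region.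
[cite: AizenmanDuminilCopinAnnals2021, §4.2, proof of Lemma 4.4] -/
theorem moment₁_lower {G : Site 3 → Site 3 → ℝ} (hG : ∀ u v, G u v = criticalCorr 3 2 ![u, v])
    {r ℓ U : ℝ} (hr : 0 < r) (hℓ : 0 < ℓ) {a b : Site 3} {A : Finset (Site 3)}
    (hab : r * G a b ≤ U) (hA : ∀ v ∈ A, ℓ ≤ r * G a v ∧ ℓ ≤ r * G v b) :
    (#A : ℝ) * (ℓ ^ 2 / (U * r)) ≤ ∑ v ∈ A, G a v * G v b / G a b := by
  have hGp : ∀ u v, 0 < G u v := fun u v => by rw [hG]; exact criticalCorr_two_pos' u v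
  rw [← nsmul_eq_mul, ← Finset.sum_const]
  exact Finset.sum_le_sum fun v hv => ratio_lower hr hℓ (hA v hv).1 (hA v hv).2 (hGp a b) hab

/-- **`M₂ ≤ (2U²/(ℓρ²)) ∑_{v,w ∈ A} ⟨σ_vσ_w⟩`** in infinite volume (each two-step term through
`twoStep_upper`; `⟨σ_vσ_w⟩ = ⟨σ₀σ_{w−v}⟩`). [cite: AizenmanDuminilCopinAnnals2021, App. A Prop. A.3] -/
theorem moment₂_upper {G : Site 3 → Site 3 → ℝ} (hG : ∀ u v, G u v = criticalCorr 3 2 ![u, v])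
    {r ℓ U : ℝ} (hr : 0 < r) (hℓ : 0 < ℓ) {a b : Site 3} {A : Finset (Site 3)}
    (hab : ℓ ≤ r * G a b) (hA : ∀ v ∈ A, r * G a v ≤ U ∧ r * G v b ≤ U) :
    ∑ v ∈ A, ∑ w ∈ A, (G a v * G v w * G w b + G a w * G w v * G v b) / G a b ≤
      2 * U ^ 2 / (ℓ * r) * ∑ v ∈ A, ∑ w ∈ A, criticalTwoPoint 3 (w - v) := by
  have hG0 : ∀ u v, 0 ≤ G u v := fun u v => by rw [hG]; exact (criticalCorr_two_pos' u v).le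
  rw [Finset.mul_sum]
  refine Finset.sum_le_sum fun v hv => ?_
  rw [Finset.mul_sum]
  refine Finset.sum_le_sum fun w hw => ?_
  have hvw : G v w = criticalTwoPoint 3 (w - v) := by rw [hG]; exact criticalCorr_two_pair v w
  have hwv : G w v = criticalTwoPoint 3 (w - v) := by
    rw [hG]; exact (criticalCorr_two_pair_comm w v).trans (criticalCorr_two_pair v w)
  rw [hvw, hwv]
  exact twoStep_upper hr hℓ (hG0 _ _) (hG0 _ _) (hG0 _ _) (hG0 _ _) (criticalTwoPoint_nonneg' _)
    (hA v hv).1 (hA w hw).2 (hA w hw).1 (hA v hv).2 hab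

/-- **`E_s ≤ (2U²/(ℓρ²)) ∑_{v ≠ w ∈ A} ‖w − v‖^{−s}⟨σ_vσ_w⟩`** in infinite volume.
[cite: AizenmanDuminilCopinAnnals2021, App. A Prop. A.3] -/
theorem energy_upper {G : Site 3 → Site 3 → ℝ} (hG : ∀ u v, G u v = criticalCorr 3 2 ![u, v])
    {r ℓ U : ℝ} (hr : 0 < r) (hℓ : 0 < ℓ) {a b : Site 3} {A : Finset (Site 3)} (s : ℝ)
    (hab : ℓ ≤ r * G a b) (hA : ∀ v ∈ A, r * G a v ≤ U ∧ r * G v b ≤ U) :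
    ∑ v ∈ A, ∑ w ∈ A.erase v, (‖v - w‖ : ℝ) ^ (-s) *
        ((G a v * G v w * G w b + G a w * G w v * G v b) / G a b) ≤
      2 * U ^ 2 / (ℓ * r) *
        ∑ v ∈ A, ∑ w ∈ A.erase v, (‖w - v‖ : ℝ) ^ (-s) * criticalTwoPoint 3 (w - v) := by
  have hG0 : ∀ u v, 0 ≤ G u v := fun u v => by rw [hG]; exact (criticalCorr_two_pos' u v).le
  rw [Finset.mul_sum]
  refine Finset.sum_le_sum fun v hv => ?_
  rw [Finset.mul_sum]
  refine Finset.sum_le_sum fun w hw => ?_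
  have hw' : w ∈ A := Finset.mem_of_mem_erase hw
  have hvw : G v w = criticalTwoPoint 3 (w - v) := by rw [hG]; exact criticalCorr_two_pair v w
  have hwv : G w v = criticalTwoPoint 3 (w - v) := by
    rw [hG]; exact (criticalCorr_two_pair_comm w v).trans (criticalCorr_two_pair v w)
  rw [hvw, hwv, norm_sub_rev v w]
  have hn0 : 0 ≤ (‖w - v‖ : ℝ) ^ (-s) := Real.rpow_nonneg (norm_nonneg _) _
  have h := twoStep_upper hr hℓ (hG0 _ _) (hG0 _ _) (hG0 _ _) (hG0 _ _) (criticalTwoPoint_nonneg' _)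
    (hA v hv).1 (hA w hw').2 (hA w hw').1 (hA v hv).2 hab (g := criticalTwoPoint 3 (w - v))
  calc (‖w - v‖ : ℝ) ^ (-s) * ((G a v * criticalTwoPoint 3 (w - v) * G w b +
        G a w * criticalTwoPoint 3 (w - v) * G v b) / G a b)
      ≤ (‖w - v‖ : ℝ) ^ (-s) * (2 * U ^ 2 / (ℓ * r) * criticalTwoPoint 3 (w - v)) :=
        mul_le_mul_of_nonneg_left h hn0
    _ = 2 * U ^ 2 / (ℓ * r) * ((‖w - v‖ : ℝ) ^ (-s) * criticalTwoPoint 3 (w - v)) := by ring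

/-! ## §C. Translation invariance: inner sums over the region are lattice sums over `Λ_{2n}` -/

/-- Differences of two sites of `Λ_n` lie in `Λ_{2n}`. [folklore] -/
theorem sub_mem_box_two_mul {n : ℕ} {u u' : Site 3} (hu : u ∈ box 3 n) (hu' : u' ∈ box 3 n) :
    u' - u ∈ box 3 (2 * n) := by
  rw [mem_box] at hu hu' ⊢
  intro j
  obtain ⟨hu1, hu2⟩ := hu j
  obtain ⟨hu1', hu2'⟩ := hu' j
  simp only [Pi.sub_apply]
  push_cast
  omega

/-- `∑_{w ∈ Λ_n + p} f(w − v) ≤ ∑_{y ∈ Λ_{2n}} f(y)` for `v ∈ Λ_n + p` and `f ≥ 0`. [folklore] -/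
theorem sum_region_sub_le {f : Site 3 → ℝ} (hf : ∀ y, 0 ≤ f y) (n : ℕ) (p : Site 3) {v : Site 3}
    (hv : v ∈ (box 3 n).image (fun u => u + p)) :
    ∑ w ∈ (box 3 n).image (fun u => u + p), f (w - v) ≤ ∑ y ∈ box 3 (2 * n), f y := by
  -- adapted from the step `hinner` of `FreeCovarianceDeltaDichotomy.stub_momentRatioLowerBound`
  obtain ⟨u, hu, huv⟩ := Finset.mem_image.1 hv
  have hv' : v = u + p := huv.symm
  rw [Finset.sum_image fun _ _ _ _ h => add_left_injective p h, hv']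
  simp_rw [add_sub_add_right_eq_sub]
  calc ∑ u' ∈ box 3 n, f (u' - u)
      = ∑ y ∈ (box 3 n).image (fun u' => u' - u), f y := by
        rw [Finset.sum_image fun _ _ _ _ h => sub_left_injective h]
    _ ≤ ∑ y ∈ box 3 (2 * n), f y := by
        refine Finset.sum_le_sum_of_subset_of_nonneg ?_ fun y _ _ => hf y
        exact Finset.image_subset_iff.2 fun u' hu' => sub_mem_box_two_mul hu hu'

/-- `∑_{w ∈ (Λ_n + p) ∖ {v}} f(w − v) ≤ ∑_{y ∈ Λ_{2n} ∖ {0}} f(y)` for `v ∈ Λ_n + p` and `f ≥ 0`.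
[folklore] -/
theorem sum_region_erase_sub_le {f : Site 3 → ℝ} (hf : ∀ y, 0 ≤ f y) (n : ℕ) (p : Site 3)
    {v : Site 3} (hv : v ∈ (box 3 n).image (fun u => u + p)) :
    ∑ w ∈ ((box 3 n).image (fun u => u + p)).erase v, f (w - v) ≤
      ∑ y ∈ (box 3 (2 * n)).erase 0, f y := by
  obtain ⟨u, hu, huv⟩ := Finset.mem_image.1 hv
  calc ∑ w ∈ ((box 3 n).image (fun u => u + p)).erase v, f (w - v)
      = ∑ y ∈ (((box 3 n).image (fun u => u + p)).erase v).image (fun w => w - v), f y := by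
        rw [Finset.sum_image fun _ _ _ _ h => sub_left_injective h]
    _ ≤ ∑ y ∈ (box 3 (2 * n)).erase 0, f y := by
        refine Finset.sum_le_sum_of_subset_of_nonneg ?_ fun y _ _ => hf y
        refine Finset.image_subset_iff.2 fun w hw => ?_
        obtain ⟨hwv, hwA⟩ := Finset.mem_erase.1 hw
        obtain ⟨u', hu', rfl⟩ := Finset.mem_image.1 hwA
        refine Finset.mem_erase.2 ⟨sub_ne_zero.2 hwv, ?_⟩
        rw [← huv, add_sub_add_right_eq_sub]
        exact sub_mem_box_two_mul hu hu'

/-! ## §D. The mesh integers -/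

/-- **The mesh integers**: for `0 < δ ≤ 1/4` with `δ < (2^{i₀} + 2)⁻¹`, the integers `n = ⌊1/δ⌋ − 1`
and `J = ⌊log₂ n⌋` satisfy `(n+1)δ ∈ [3/4, 1]`, `2^{i₀} ≤ n`, `2^J ≤ n < 2^{J+1}`, `i₀ ≤ J`,
`δ2^J ∈ [1/4, 1]`. [folklore] -/
theorem mesh_integers {δ : ℝ} (hδpos : 0 < δ) (hδ4 : δ ≤ 1/4) {i₀ : ℕ}
    (hδi : δ < ((2:ℝ) ^ i₀ + 2)⁻¹) :
    ((((⌊δ⁻¹⌋₊ - 1 : ℕ) : ℝ) + 1) * δ ≤ 1 ∧ 3/4 ≤ (((⌊δ⁻¹⌋₊ - 1 : ℕ) : ℝ) + 1) * δ) ∧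
      (2 ^ i₀ ≤ ⌊δ⁻¹⌋₊ - 1 ∧ 1 ≤ ⌊δ⁻¹⌋₊ - 1) ∧
      (2 ^ Nat.log 2 (⌊δ⁻¹⌋₊ - 1) ≤ ⌊δ⁻¹⌋₊ - 1 ∧
        ⌊δ⁻¹⌋₊ - 1 < 2 ^ (Nat.log 2 (⌊δ⁻¹⌋₊ - 1) + 1) ∧ i₀ ≤ Nat.log 2 (⌊δ⁻¹⌋₊ - 1)) ∧
      (1/4 ≤ δ * 2 ^ Nat.log 2 (⌊δ⁻¹⌋₊ - 1) ∧ δ * 2 ^ Nat.log 2 (⌊δ⁻¹⌋₊ - 1) ≤ 1) := by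
  -- adapted from step ③ of `FreeCovarianceDeltaDichotomy.stub_momentRatioLowerBound`
  have hδ1 : δ ≤ 1 := hδ4.trans (by norm_num)
  set N : ℕ := ⌊δ⁻¹⌋₊ with hN
  set n : ℕ := N - 1 with hn
  have hinv1 : (1:ℝ) ≤ δ⁻¹ := (one_le_inv₀ hδpos).2 hδ1
  have hN1 : 1 ≤ N := Nat.le_floor (by exact_mod_cast hinv1)
  have hnN : n + 1 = N := by omega
  have hNle : (N:ℝ) ≤ δ⁻¹ := Nat.floor_le (by positivity)
  have hNgt : δ⁻¹ < (N:ℝ) + 1 := Nat.lt_floor_add_one _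
  have hnR : (n:ℝ) + 1 = N := by exact_mod_cast hnN
  have hn1δ : ((n:ℝ) + 1) * δ ≤ 1 := by
    rw [hnR]
    calc (N:ℝ) * δ ≤ δ⁻¹ * δ := mul_le_mul_of_nonneg_right hNle hδpos.le
      _ = 1 := inv_mul_cancel₀ hδpos.ne'
  have hn34 : 3/4 ≤ ((n:ℝ) + 1) * δ := by
    have e : (δ⁻¹ - 1) * δ = 1 - δ := by rw [sub_mul, inv_mul_cancel₀ hδpos.ne', one_mul]
    have hlt : (δ⁻¹ - 1) * δ < ((n:ℝ) + 1) * δ :=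
      mul_lt_mul_of_pos_right (by linarith only [hNgt, hnR]) hδpos
    linarith only [e, hlt, hδ4]
  have hi₀n : 2 ^ i₀ ≤ n := by
    have h := (lt_inv_comm₀ hδpos (by positivity)).1 hδi
    have : (2:ℝ) ^ i₀ < n := by linarith only [h, hNgt, hnR]
    exact_mod_cast this.le
  have hn1 : 1 ≤ n := le_trans (Nat.one_le_two_pow (n := i₀)) hi₀n
  have hn0 : n ≠ 0 := by omega
  set J : ℕ := Nat.log 2 n with hJ
  have hJn : 2 ^ J ≤ n := Nat.pow_log_le_self 2 hn0
  have hnJ : n < 2 ^ (J + 1) := Nat.lt_pow_succ_log_self one_lt_two n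
  have hi₀J : i₀ ≤ J := Nat.le_log_of_pow_le one_lt_two hi₀n
  have hJnR : (2:ℝ) ^ J ≤ n := by exact_mod_cast hJn
  have hnJR : (n:ℝ) + 1 ≤ 2 * 2 ^ J := by
    have : n + 1 ≤ 2 * 2 ^ J := by rw [pow_succ] at hnJ; omega
    exact_mod_cast this
  have ht1 : δ * 2 ^ J ≤ 1 := by
    have h2 : δ * 2 ^ J ≤ δ * n := mul_le_mul_of_nonneg_left hJnR hδpos.le
    nlinarith only [h2, hn1δ, hδpos]
  have ht4 : 1/4 ≤ δ * 2 ^ J := by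
    have h2 : ((n:ℝ) + 1) * δ ≤ 2 * 2 ^ J * δ := mul_le_mul_of_nonneg_right hnJR hδpos.le
    linarith only [h2, hn34]
  exact ⟨⟨hn1δ, hn34⟩, ⟨hi₀n, hn1⟩, ⟨hJn, hnJ, hi₀J⟩, ht4, ht1⟩

/-! ## §E. Real arithmetic of the three conclusions -/

/-- **Arithmetic of the Paley–Zygmund ratio**: `M₁ ≥ |A|τ`, `τ = ℓ²/(Uρ²)`,
`M₂ ≤ σ|A|K n³U/ρ²`, `σ = 2U²/(ℓρ²)`, `n³ ≤ |A|` give `2c₁M₂ ≤ M₁²`, `c₁ = ℓ⁵/(4KU⁵)` — the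
amplitude `ρ²` cancels. [folklore] -/
theorem ratio_arith {ℓ U r K cardA n3 M₁ M₂ : ℝ} (hℓ : 0 < ℓ) (hU : 0 < U) (hr : 0 < r) (hK : 0 < K)
    (hn3 : 0 ≤ n3) (hcard : n3 ≤ cardA) (hM₁ : cardA * (ℓ ^ 2 / (U * r)) ≤ M₁)
    (hM₂ : M₂ ≤ 2 * U ^ 2 / (ℓ * r) * (cardA * (K * n3 * (U / r)))) :
    2 * (ℓ ^ 5 / (4 * K * U ^ 5)) * M₂ ≤ M₁ ^ 2 := by
  -- adapted from step `hkey` of `FreeCovarianceDeltaDichotomy.stub_momentRatioLowerBound`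
  have hcard0 : 0 ≤ cardA := hn3.trans hcard
  calc 2 * (ℓ ^ 5 / (4 * K * U ^ 5)) * M₂
      ≤ 2 * (ℓ ^ 5 / (4 * K * U ^ 5)) * (2 * U ^ 2 / (ℓ * r) * (cardA * (K * n3 * (U / r)))) :=
        mul_le_mul_of_nonneg_left hM₂ (by positivity)
    _ = (ℓ ^ 4 / (U ^ 2 * r ^ 2)) * cardA * n3 := by field_simp; ring
    _ ≤ (ℓ ^ 4 / (U ^ 2 * r ^ 2)) * cardA * cardA :=
        mul_le_mul_of_nonneg_left hcard (by positivity)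
    _ = (cardA * (ℓ ^ 2 / (U * r))) ^ 2 := by field_simp
    _ ≤ M₁ ^ 2 := pow_le_pow_left₀ (by positivity) hM₁ 2

/-- **Arithmetic of the energy bound**: `M₁ ≥ |A|τ`, `E ≤ σ|A|K₁n³(2^sC^sR^{-s})U/ρ²`, `n³ ≤ |A|`
give `E ≤ (c₂/2)R^{-s}M₁²`, `c₂ = 4·2^sC^sK₁U⁵/ℓ⁵`. [folklore] -/
theorem energy_arith {ℓ U r K₁ cardA n3 M₁ E w : ℝ} (hℓ : 0 < ℓ) (hU : 0 < U) (hr : 0 < r)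
    (hK₁ : 0 ≤ K₁) (hw : 0 ≤ w) (hn3 : 0 ≤ n3) (hcard : n3 ≤ cardA)
    (hM₁ : cardA * (ℓ ^ 2 / (U * r)) ≤ M₁)
    (hE : E ≤ 2 * U ^ 2 / (ℓ * r) * (cardA * (K₁ * n3 * w * (U / r)))) :
    E ≤ (4 * w * K₁ * U ^ 5 / ℓ ^ 5) / 2 * M₁ ^ 2 := by
  have hcard0 : 0 ≤ cardA := hn3.trans hcard
  calc E ≤ 2 * U ^ 2 / (ℓ * r) * (cardA * (K₁ * n3 * w * (U / r))) := hE
    _ = (2 * U ^ 3 * K₁ * w / (ℓ * r ^ 2)) * cardA * n3 := by field_simp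
    _ ≤ (2 * U ^ 3 * K₁ * w / (ℓ * r ^ 2)) * cardA * cardA :=
        mul_le_mul_of_nonneg_left hcard (by positivity)
    _ = (4 * w * K₁ * U ^ 5 / ℓ ^ 5) / 2 * (cardA * (ℓ ^ 2 / (U * r))) ^ 2 := by field_simp; ring
    _ ≤ (4 * w * K₁ * U ^ 5 / ℓ ^ 5) / 2 * M₁ ^ 2 :=
        mul_le_mul_of_nonneg_left (pow_le_pow_left₀ (by positivity) hM₁ 2) (by positivity)

/-- **Arithmetic of the mass threshold**: with `T = 1/δ`, a two-point lower bound
`(C₀T)^{-p} ≤ ⟨σ_{x̃₀}σ_{x̃₁}⟩`, `M₁ ≥ T³ℓ²⟨σ_{x̃₀}σ_{x̃₁}⟩/U²`, `R ≤ C₂T` and `QT^{-ε} < 1`,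
`ε = 3 − p − s`, one gets `2Rˢ < M₁`. [folklore] -/
theorem mass_arith {T ε p s ℓ U C₀ C₂ g M R : ℝ} (hT : 0 < T) (hℓ : 0 < ℓ) (hU : 0 < U)
    (hC₀ : 0 < C₀) (hC₂ : 0 < C₂) (hs : 0 < s) (hε : ε = 3 - p - s)
    (hg : (C₀ * T) ^ (-p) ≤ g) (hM : T ^ (3:ℝ) * (ℓ ^ 2 * g / U ^ 2) ≤ M)
    (hR : R ≤ C₂ * T) (hR0 : 0 < R)
    (hQ : 2 * C₂ ^ s * U ^ 2 * C₀ ^ p / ℓ ^ 2 < T ^ ε) :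
    2 * R ^ s < M := by
  have h1 : R ^ s ≤ C₂ ^ s * T ^ s := by
    rw [← Real.mul_rpow hC₂.le hT.le]; exact Real.rpow_le_rpow hR0.le hR hs.le
  have hTs : 0 < T ^ s := Real.rpow_pos_of_pos hT s
  have hTp : 0 < T ^ (-p) := Real.rpow_pos_of_pos hT _
  have hC₀p : 0 < C₀ ^ p := Real.rpow_pos_of_pos hC₀ p
  have e1 : (C₀ * T) ^ (-p) = (C₀ ^ p)⁻¹ * T ^ (-p) := by
    rw [Real.mul_rpow hC₀.le hT.le, Real.rpow_neg hC₀.le]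
  have e2 : T ^ (3:ℝ) * T ^ (-p) = T ^ ε * T ^ s := by
    rw [← Real.rpow_add hT, ← Real.rpow_add hT, hε]; ring_nf
  have h2 : T ^ (3:ℝ) * (ℓ ^ 2 * ((C₀ ^ p)⁻¹ * T ^ (-p)) / U ^ 2) ≤ M := by
    refine le_trans ?_ hM
    rw [← e1]
    gcongr
  have h3 : T ^ (3:ℝ) * (ℓ ^ 2 * ((C₀ ^ p)⁻¹ * T ^ (-p)) / U ^ 2) =
      ℓ ^ 2 / (C₀ ^ p * U ^ 2) * T ^ ε * T ^ s := by
    rw [show T ^ (3:ℝ) * (ℓ ^ 2 * ((C₀ ^ p)⁻¹ * T ^ (-p)) / U ^ 2) =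
      ℓ ^ 2 / (C₀ ^ p * U ^ 2) * (T ^ (3:ℝ) * T ^ (-p)) by field_simp, e2, mul_assoc]
  rw [h3] at h2
  have h4 : 2 * C₂ ^ s < ℓ ^ 2 / (C₀ ^ p * U ^ 2) * T ^ ε := by
    rw [div_mul_eq_mul_div, lt_div_iff₀ (by positivity)]
    rw [div_lt_iff₀ (by positivity)] at hQ
    nlinarith
  calc 2 * R ^ s ≤ 2 * C₂ ^ s * T ^ s := by linarith
    _ < ℓ ^ 2 / (C₀ ^ p * U ^ 2) * T ^ ε * T ^ s := mul_lt_mul_of_pos_right h4 hTs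
    _ ≤ M := h2

end OneArm

/-! ## Bookkeeping (the registered sub-goal through which this helper file lands `--supports`) -/

/-- **Registered bookkeeping stub `stub_oneArmAsymptoticsEstimates`** (sub-goal of
`stub_oneArmAsymptotics`, helper file 1/2): the first one-arm moment of the free box converges, as
`Λ_L ↑ ℤ³`, to the infinite-volume sum of three-point ratios of the critical pair correlator. [folklore] -/
theorem stub_oneArmAsymptoticsEstimates :
    ∀ (a b : Site 3) (A : Finset (Site 3)), Tendsto (fun L : ℕ => oneArmMoment₁ L a b A) atTop
      (𝓝 (∑ v ∈ A, criticalCorr 3 2 ![a, v] * criticalCorr 3 2 ![v, b] / criticalCorr 3 2 ![a, b])) :=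
  fun a b A => OneArm.tendsto_oneArmMoment₁ (fun _ _ => rfl) a b A

end Summit.CriticalPhenomena.Ising3DConformalLimit.Cruxes.GaussianLimitNotScreened.KaramataAmplitudeBlindMerging

end
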